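import Summits.ABC.IUTFork.Thm311ToCor312
import Summits.ABC.IUTFork.Cor312PinnedCountermodel
import HarnessLib

/-!
# D-0123(C) IUT REPAIR-CATALOGUE (rung LADDER-ABC:A2), NEW row RC-429 (lit-1 sweep row L1-90; KEY wake/KEY-abc-iut-rcat-tst-8-RC-429.md):
# [IUTchIII] Rmk 3.9.5 (ii)–(vi) — the «log-volume hull-approximants» `Φ(P) ⊇ Ξ(P)` and the «⊼-formalism», typed as
# claim-tagged readings over `Cor312.Setting`, with their KERNEL-CLOSE cells (tester abc-iut-rcat-tst-8)

Record file (D-0012) of the abc-iut cell. TAKES NO SIDE on [IUTchIII] Cor. 3.12 / [IUTchIV] Thm. 1.10 or on any author (D-0045);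
nothing here asserts abc proved or refuted. The row is a READING located in the author's own 2020 text; every `def` below is a
`Prop`-valued HYPOTHESIS or a print-defined SET over the frozen vocabulary (`Cor312.Setting`: `frame`, `hull`, `logvol`,
`possibleImages`, `thetaHull`, `qRegion`), never a Literature fact, never asserted; typed ≠ proved; located ≠ adjudicated;
refuted-AS-TYPED ≠ refuted-in-print. Frozen files are IMPORTED and consumed BY NAME; no new `Prop` fact; standard axioms only.

## THE SOURCE (cell render `HOME/lit/renders/IUTchIII-kurims-url-4b091feeb646/`, kurims ms May 2020, pp. 127–130)
Rmk 3.9.5 (ii) p. 127 l. 25–53: `ℙ` = direct product regions, `ℍ` = hulls, `φ : ℙ → ℍ` characterised by (P1)–(P3),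
`φ(P) = ⋂_{ℍ ∋ H ⊇ P} H`. (iii) p. 128 l. 9–39: «Φ(P) := {H ∈ ℍ | φ(P) ⊇ H, (μ^log(φ(P)) ≥) μ^log(H) ≥ μ^log(P)} ⊆ ℍ;
Ξ(P) := {H ∈ ℍ | φ(P) ⊇ H, (μ^log(φ(P)) ≥) μ^log(H) = μ^log(P)} ⊆ Φ(P); H^Φ(P) := ⋃_{H∈Φ(P)} H ⊆ φ(P); H^Ξ(P) := ⋃_{H∈Ξ(P)} H
⊆ H^Φ(P) ⊆ φ(P). Thus, one may think of elements ∈ Φ(P) or ∈ Ξ(P) as “log-volume approximations” of P by means of hulls ∈ ℍ.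
If one thinks of distinct elements ∈ Φ(P) or ∈ Ξ(P) … as a sort of indeterminacy [i.e., in the assignment to P of a specific
element ∈ ℍ!], then this indeterminacy is compact, i.e., … all possible choices … are contained in the compact set φ(P) ∈ ℍ.»
(iv) p. 128 l. 40 – p. 129 l. 38: «φ(P) ∈ Φ(P), so φ(P) = H^Φ(P), but the issue of whether or not Ξ(P) = ∅ is not so immediate
… (Ξ3) … there exist P ∈ ℙ for which μ^log(P) < μ^log(H^Ξ(P)) (≤ μ^log(H^Φ(P)) = μ^log(φ(P)))», with the `ℚ_p × ℚ_p` example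
`μ_I(P) = μ_I(H0) = 1 < 2 − p^{−1} = μ_I(H0 ∪ H1)`, hull `H_P` of volume `p`. (vi) p. 130 l. 22–29: «the abstract set-theoretic
“⊼-formalism” of (v) — i.e., where one takes “S ⊆ E” to be φ(P) ⊆ 𝓘^ℚ((−)) — yields a convenient tool for identifying P with its
various log-volume hull-approximants ∈ Φ(P) or ∈ Ξ(P) …, i.e., of passing to a quotient in which the indeterminacy discussed in
(iii) is eliminated.» [claim: Mochizuki2012, status: disputed]

## THE TYPING (this seat's reading; the referee lanes grade it)
At OUR interface the packet `𝓘^ℚ(^{S^±_{j+1}};^{n,∘}𝒟^⊢_{v_ℚ})` carries the hull frame `P.frame j v_ℚ` (hull-sets `Hul`, hull operator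
`hull` = print's `φ`) and the mono-analytic log-volume `(S.D P.n).logvol j v_ℚ` (print's `μ^log`). Print's `Φ(U)`, `Ξ(U)` are typed
VERBATIM as `PhiApprox` / `XiApprox` (§1). The Cor. 3.12 region `U` is the union of the possible images of the Θ-pilot object, whose
hull `φ(U)` is `P.thetaHull`. Reading the «⊼-identification of U with a hull-approximant» as a LICENCE for the comparison of Step (xi)
(the q-pilot image lies in SOME approximant of `U`) gives two claim-tagged HYPOTHESES (§2): **`PhiLicence`** (approximant ∈ Φ(U)) and
**`XiLicence`** (approximant ∈ Ξ(U), an EQUAL-VOLUME hull). No judgement on whether print uses Φ/Ξ in Step (xi) (print's `−|log(Θ)|`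
reads `φ(U)` itself, Cor. 3.12 p. 173 l. 43 – p. 174 l. 3 = our `thetaLocal`).

## KERNEL-CLOSE CELLS (this file)
§1 print's (iii)/(iv) structure PROVED at the interface: `Ξ ⊆ Φ`, `H^Φ ⊆ φ`, `φ(U) ∈ Φ(U)` and `H^Φ(U) = φ(U)` (given the volume
inequality `μ(U) ≤ μ(φ(U))`, i.e. monotonicity on an admissible `U`). §2 `PhiLicence` ⟺ the (xi-f) `Licence` of record
(`phiLicence_iff_licence`: k4-type, it RESTATES the open node — `Cor312Proof.xi_f_holds_honest_iff_statement` p418650 — since `φ(U)`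
is itself an approximant); `XiLicence` ⟹ `Licence` ⟹ Statement (`statement_of_xiLicence`, a DOOR, stronger supplier than the
licence) and `XiLicence` ⟹ the UNION-VOLUME inequality `qLocal ≤ μ^log(U)` packetwise (`qLocal_le_logvol_sUnion_of_xiLicence`: the
equal-volume-subregion content of RC-140 / RC-614, words BY NAME there). §3 at abc-iut-w4-d101's pinned countermodel
(`Cor312Vol.PinnedWitness.pinned_countermodel` p419720) the licence fails, hence BOTH approximant licences FAIL together with the
Statement (`hullApprox_licences_fail_at_CM`). [claim: Mochizuki2012, status: disputed]
-/

noncomputable section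

open Set

namespace Summit.ABC.IUTFork.Repair.CandMochizukiHullApprox

open Thm311 Cor312 Cor312Vol Thm311ToCor312 Literature.IUT.LogThetaLattice

variable {T : ThetaIndex} {S : Situation T} (P : Cor312.Setting S)

/-! ## 1. Print's hull-approximants Φ(U) ⊇ Ξ(U) (Rmk 3.9.5 (iii)), verbatim over the packet frame -/

/-- **`Φ(U)`** (Rmk 3.9.5 (iii), p. 128 l. 9–12): the hull-sets `H` with `φ(U) ⊇ H` and `μ^log(H) ≥ μ^log(U)` — «log-volume
approximations of U by means of hulls». Print-defined SET (no hypothesis). [claim: Mochizuki2012, status: disputed] -/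
def PhiApprox (j : T.Label) (vQ : T.VQ) (U : Set (S.L.Packet j vQ)) : Set (Set (S.L.Packet j vQ)) :=
  {H | H ∈ (P.frame j vQ).Hul ∧ H ⊆ (P.frame j vQ).hull U ∧ (S.D P.n).logvol j vQ U ≤ (S.D P.n).logvol j vQ H}

/-- **`Ξ(U)`** (Rmk 3.9.5 (iii), p. 128 l. 13–15): the hull-sets `H` with `φ(U) ⊇ H` and `μ^log(H) = μ^log(U)` — the EQUAL-VOLUME
hull-approximants. Print-defined SET. [claim: Mochizuki2012, status: disputed] -/
def XiApprox (j : T.Label) (vQ : T.VQ) (U : Set (S.L.Packet j vQ)) : Set (Set (S.L.Packet j vQ)) :=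
  {H | H ∈ (P.frame j vQ).Hul ∧ H ⊆ (P.frame j vQ).hull U ∧ (S.D P.n).logvol j vQ H = (S.D P.n).logvol j vQ U}

variable {P}

/-- `Ξ(U) ⊆ Φ(U)` (p. 128 l. 15). [folklore] -/
theorem xiApprox_subset_phiApprox (j : T.Label) (vQ : T.VQ) (U : Set (S.L.Packet j vQ)) :
    XiApprox P j vQ U ⊆ PhiApprox P j vQ U :=
  fun _ ⟨hH, hsub, hvol⟩ => ⟨hH, hsub, hvol.ge⟩

/-- `H^Φ(U) ⊆ φ(U)` (p. 128 l. 16–21): the union of the approximants lies in the hull — «this indeterminacy is compact». [folklore] -/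
theorem sUnion_phiApprox_subset_hull (j : T.Label) (vQ : T.VQ) (U : Set (S.L.Packet j vQ)) :
    ⋃₀ PhiApprox P j vQ U ⊆ (P.frame j vQ).hull U :=
  Set.sUnion_subset fun _ hH => hH.2.1

/-- `H^Ξ(U) ⊆ H^Φ(U)` (p. 128 l. 21–26). [folklore] -/
theorem sUnion_xiApprox_subset_sUnion_phiApprox (j : T.Label) (vQ : T.VQ) (U : Set (S.L.Packet j vQ)) :
    ⋃₀ XiApprox P j vQ U ⊆ ⋃₀ PhiApprox P j vQ U :=
  Set.sUnion_subset_sUnion (xiApprox_subset_phiApprox j vQ U)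

/-- **(iv) «`φ(U) ∈ Φ(U)`»** (p. 128 l. 41) whenever `U` is relatively compact and admits its hull (so `φ(U)` is a hull-set) and
`μ^log(U) ≤ μ^log(φ(U))` (print: monotonicity of the log-volume on regions). [folklore] -/
theorem hull_mem_phiApprox {j : T.Label} {vQ : T.VQ} {U : Set (S.L.Packet j vQ)} (hb : (P.frame j vQ).IsBounded U)
    (hh : (P.frame j vQ).HasHull U) (hvol : (S.D P.n).logvol j vQ U ≤ (S.D P.n).logvol j vQ ((P.frame j vQ).hull U)) :
    (P.frame j vQ).hull U ∈ PhiApprox P j vQ U :=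
  ⟨(P.frame j vQ).hull_mem_of_hasHull hb hh, subset_rfl, hvol⟩

/-- **(iv) «so `φ(U) = H^Φ(U)`»** (p. 128 l. 41), under the same conditions. [folklore] -/
theorem sUnion_phiApprox_eq_hull {j : T.Label} {vQ : T.VQ} {U : Set (S.L.Packet j vQ)} (hb : (P.frame j vQ).IsBounded U)
    (hh : (P.frame j vQ).HasHull U) (hvol : (S.D P.n).logvol j vQ U ≤ (S.D P.n).logvol j vQ ((P.frame j vQ).hull U)) :
    ⋃₀ PhiApprox P j vQ U = (P.frame j vQ).hull U :=
  (sUnion_phiApprox_subset_hull j vQ U).antisymm (Set.subset_sUnion_of_mem (hull_mem_phiApprox hb hh hvol))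

/-- An equal-volume approximant has the volume of `U` and lies in the hull (unfolding). [folklore] -/
theorem logvol_eq_of_mem_xiApprox {j : T.Label} {vQ : T.VQ} {U H : Set (S.L.Packet j vQ)} (h : H ∈ XiApprox P j vQ U) :
    H ∈ (P.frame j vQ).Hul ∧ H ⊆ (P.frame j vQ).hull U ∧ (S.D P.n).logvol j vQ H = (S.D P.n).logvol j vQ U :=
  h

variable (P)

/-! ## 2. The «⊼-identification» read as a licence for Step (xi): two claim-tagged hypotheses -/

/-- **`PhiLicence`** — the q-pilot image at every label `j ∈ 𝔽_l^⋇` lies in SOME log-volume hull-approximant `H ∈ Φ(U)` of the union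
`U` of the possible images of the Θ-pilot object (Rmk 3.9.5 (vi): «identifying U with its various log-volume hull-approximants
∈ Φ(U)», read as the comparison licence). Claim-tagged HYPOTHESIS of the row; never asserted. [claim: Mochizuki2012, status: disputed] -/
@[claim "Mochizuki2012" "disputed"]
def PhiLicence : Prop :=
  ∀ (i : Fin T.lstar) (vQ : T.VQ), ∃ H ∈ PhiApprox P (Setting.labelSucc i) vQ (⋃₀ P.possibleImages (Setting.labelSucc i) vQ),
    P.qRegion (Setting.labelSucc i) vQ ⊆ H

/-- **`XiLicence`** — the same with an EQUAL-VOLUME approximant `H ∈ Ξ(U)` (Rmk 3.9.5 (iii)/(vi)). Claim-tagged HYPOTHESIS; never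
asserted. [claim: Mochizuki2012, status: disputed] -/
@[claim "Mochizuki2012" "disputed"]
def XiLicence : Prop :=
  ∀ (i : Fin T.lstar) (vQ : T.VQ), ∃ H ∈ XiApprox P (Setting.labelSucc i) vQ (⋃₀ P.possibleImages (Setting.labelSucc i) vQ),
    P.qRegion (Setting.labelSucc i) vQ ⊆ H

variable {P}

/-- `PhiLicence` ⟹ the (xi-f) `Licence` (every approximant lies in `φ(U) = thetaHull`). [folklore] -/
theorem licence_of_phiLicence (h : PhiLicence P) : Licence P := fun i vQ => by
  obtain ⟨H, ⟨-, hsub, -⟩, hq⟩ := h i vQ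
  exact hq.trans hsub

/-- `XiLicence` ⟹ `PhiLicence` (`Ξ ⊆ Φ`). [folklore] -/
theorem phiLicence_of_xiLicence (h : XiLicence P) : PhiLicence P := fun i vQ => by
  obtain ⟨H, hH, hq⟩ := h i vQ
  exact ⟨H, xiApprox_subset_phiApprox _ vQ _ hH, hq⟩

/-- `XiLicence` ⟹ the (xi-f) `Licence`. [folklore] -/
theorem licence_of_xiLicence (h : XiLicence P) : Licence P :=
  licence_of_phiLicence (phiLicence_of_xiLicence h)

/-- `Licence` ⟹ `PhiLicence` whenever `φ(U)` is itself an approximant of `U` at every label of `𝔽_l^⋇` — i.e. under `HullDefined`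
(supplied by `ThetaFinite` / the bridge hypotheses) and the volume inequality `μ(U) ≤ μ(φ(U))`. [folklore] -/
theorem phiLicence_of_licence
    (hvol : ∀ (i : Fin T.lstar) (vQ : T.VQ), (S.D P.n).logvol _ vQ (⋃₀ P.possibleImages (Setting.labelSucc i) vQ) ≤
      (S.D P.n).logvol _ vQ (P.thetaHull (Setting.labelSucc i) vQ))
    (hdef : ∀ (i : Fin T.lstar) (vQ : T.VQ), P.HullDefined (Setting.labelSucc i) vQ) (h : Licence P) : PhiLicence P :=
  fun i vQ => ⟨P.thetaHull _ vQ, hull_mem_phiApprox (hdef i vQ).1 (hdef i vQ).2 (hvol i vQ), h i vQ⟩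

/-- **`PhiLicence` ⟺ `Licence` (k4-type: the Φ-approximant licence RESTATES the (xi-f) licence of record)**, under the bridge
hypotheses and the volume inequality `μ(U) ≤ μ(φ(U))` at the labels of `𝔽_l^⋇`. [folklore] -/
theorem phiLicence_iff_licence (HB : BridgeHyps P)
    (hvol : ∀ (i : Fin T.lstar) (vQ : T.VQ), (S.D P.n).logvol _ vQ (⋃₀ P.possibleImages (Setting.labelSucc i) vQ) ≤
      (S.D P.n).logvol _ vQ (P.thetaHull (Setting.labelSucc i) vQ)) :
    PhiLicence P ↔ Licence P :=
  ⟨licence_of_phiLicence, phiLicence_of_licence hvol (hullDefined_of_finite HB)⟩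

/-- The volume inequality `μ(U) ≤ μ(φ(U))` holds as soon as the union `U` is an ADMISSIBLE region (print: `U ∈ ℙ` has a log-volume)
under the bridge hypotheses (monotone log-volume, `HullDefined`). [folklore] -/
theorem logvol_sUnion_le_thetaHull (HB : BridgeHyps P)
    (hU : ∀ (i : Fin T.lstar) (vQ : T.VQ), (S.D P.n).Adm _ vQ (⋃₀ P.possibleImages (Setting.labelSucc i) vQ))
    (i : Fin T.lstar) (vQ : T.VQ) :
    (S.D P.n).logvol _ vQ (⋃₀ P.possibleImages (Setting.labelSucc i) vQ) ≤
      (S.D P.n).logvol _ vQ (P.thetaHull (Setting.labelSucc i) vQ) :=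
  HB.mono i vQ (hU i vQ) (P.thetaHull_adm (hullDefined_of_finite HB i vQ)) ((P.frame _ vQ).subset_hull _)

/-- **THE DOOR: `XiLicence` ⟹ the typed Statement of Cor. 3.12** (via the licence of record and abc-iut-c312-6's edge
`statement_of_licence`), under the bridge hypotheses. [claim: Mochizuki2012, status: disputed] -/
theorem statement_of_xiLicence (HB : BridgeHyps P) (h : XiLicence P) : P.Statement :=
  statement_of_licence HB (licence_of_xiLicence h)

/-- Likewise `PhiLicence` ⟹ Statement. [claim: Mochizuki2012, status: disputed] -/
theorem statement_of_phiLicence (HB : BridgeHyps P) (h : PhiLicence P) : P.Statement :=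
  statement_of_licence HB (licence_of_phiLicence h)

/-- **`XiLicence` carries the UNION-VOLUME inequality**: if the q-pilot image lies in an equal-volume hull-approximant `H ∈ Ξ(U)`,
then `μ^log(q) ≤ μ^log(H) = μ^log(U)` packetwise (monotone log-volume; the q-image and `H` are hull-sets, hence admissible) — the
equal-volume-subregion content of the RC-140 / RC-614 readings, STRONGER than the hull inequality the typed Statement asks.
[folklore] -/
theorem qLocal_le_logvol_sUnion_of_xiLicence (HB : BridgeHyps P) (h : XiLicence P) (i : Fin T.lstar) (vQ : T.VQ) :
    P.qLocal (Setting.labelSucc i) vQ ≤ (S.D P.n).logvol _ vQ (⋃₀ P.possibleImages (Setting.labelSucc i) vQ) := by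
  obtain ⟨H, ⟨hH, -, hvol⟩, hq⟩ := h i vQ
  rw [← hvol]
  exact HB.mono i vQ (P.hul_adm _ vQ _ (P.qRegion_mem _ vQ)) (P.hul_adm _ vQ _ hH) hq

/-- Print's (iv): «if P ∈ ℍ, then {φ(P)} = Φ(P) = Ξ(P)» has the following interface shadow — when the union `U` is itself a
hull-set, `U ∈ Ξ(U)` (so `Ξ(U) ≠ ∅` there; print: «in general, it is not so clear whether or not Ξ(P) ≠ ∅», p. 129 l. 2). [folklore] -/
theorem self_mem_xiApprox_of_mem_hul {j : T.Label} {vQ : T.VQ} {U : Set (S.L.Packet j vQ)} (hU : U ∈ (P.frame j vQ).Hul) :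
    U ∈ XiApprox P j vQ U :=
  ⟨hU, (P.frame j vQ).subset_hull U, rfl⟩

/-! ## 3. At the pinned countermodel of record both approximant licences FAIL (with the Statement) -/

section Pinned

open Cor312.Checks Cor312.IdentifiedNonVacuity Cor312Vol.NaiveWitness Cor312Vol.PinnedWitness

variable (p : ℕ) [hp : Fact p.Prime]

/-- `PhiLicence` FAILS at the pinned countermodel (it would give the (xi-f) licence, `pinnedSetting_not_licence`). [folklore] -/
theorem not_phiLicence_pinnedSetting : ¬ PhiLicence (pinnedSetting p) :=
  fun h => pinnedSetting_not_licence p (licence_of_phiLicence h)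

/-- `XiLicence` FAILS at the pinned countermodel. [folklore] -/
theorem not_xiLicence_pinnedSetting : ¬ XiLicence (pinnedSetting p) :=
  fun h => pinnedSetting_not_licence p (licence_of_xiLicence h)

/-- **KERNEL-CLOSE, PACKAGED (`p = 2`)**: at the countermodel of record — typed Thm. 3.11 ∧ BridgeHyps ∧ `|log(q)| > 0` — both
hull-approximant licences FAIL together with the (xi-f) licence and the typed Statement (polarity of a non-idle supplier:
FAILS-AT-CM). No judgement on print. [folklore] -/
theorem hullApprox_licences_fail_at_CM :
    ∃ (T : ThetaIndex) (F : FullSituation T) (P : Cor312.Setting F.toLatticeSituation.toSituation),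
      F.Statement ∧ BridgeHyps P ∧ P.AbsLogQPos ∧ ¬ PhiLicence P ∧ ¬ XiLicence P ∧ ¬ Licence P ∧ ¬ P.Statement := by
  haveI : Fact (Nat.Prime 2) := ⟨Nat.prime_two⟩
  exact ⟨toyIndex, naiveFull 2, pinnedSetting 2, naiveFull_statement 2, pinnedSetting_bridgeHyps 2, pinnedSetting_absLogQPos 2,
    not_phiLicence_pinnedSetting 2, not_xiLicence_pinnedSetting 2, pinnedSetting_not_licence 2, pinnedSetting_not_statement 2⟩

end Pinned

/-! ## 4. Print's (Ξ3) strictness at the FRAME level: a three-point hull frame (append-only, abc-iut-rcat-tst-8 gen 2)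

Rmk 3.9.5 (iv) (Ξ3) p. 129 l. 8–11: «there exist P ∈ ℙ for which μ^log(P) < μ^log(H^Ξ(P)) (≤ μ^log(H^Φ(P)) = μ^log(φ(P)))», illustrated in
print by the `ℚ_p × ℚ_p` example (region volume 1, union of two equal-volume approximants 2 − p⁻¹, hull p; rcat-tst-3 reproduced the numbers).
The SETS `PhiApprox`/`XiApprox` of §1 only read the packet's hull frame and volume; §4 records their frame-level form (`xiApproxOf`, with
`xiApprox_eq_xiApproxOf` = `rfl`) and exhibits the (Ξ3) PHENOMENON already on a three-point frame: `X = Fin 3`, hull-sets `{0,1}`, `{1,2}`,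
`{0,1,2}`, volume = cardinality, region `P = {0,2}`: `φ(P) = {0,1,2}`, `Ξ(P) = {{0,1},{1,2}}`, `H^Ξ(P) = φ(P)`, and `μ(P) = 2 < 3 = μ(H^Ξ(P))
= μ(φ(P))` — the interface shadow of print's toy (two equal-volume approximants whose union is the whole hull). No judgement on print.
[claim: Mochizuki2012, status: disputed] -/

section FrameLevel

variable {X : Type} (F : HullFrame X) (μ : Set X → ℝ)

/-- `Ξ(U)` at the level of a bare hull frame with a volume function (print's definition reads nothing else). [claim: Mochizuki2012, status: disputed] -/
def xiApproxOf (U : Set X) : Set (Set X) := {H | H ∈ F.Hul ∧ H ⊆ F.hull U ∧ μ H = μ U}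

/-- The Setting-level `XiApprox` of §1 IS the frame-level set for the packet frame and the column-`n` log-volume. [folklore] -/
theorem xiApprox_eq_xiApproxOf {T : ThetaIndex} {S : Situation T} (P : Cor312.Setting S) (j : T.Label) (vQ : T.VQ)
    (U : Set (S.L.Packet j vQ)) : XiApprox P j vQ U = xiApproxOf (P.frame j vQ) ((S.D P.n).logvol j vQ) U :=
  rfl

end FrameLevel

section ThreePoint

/-- The three hull-sets `{0,1}`, `{1,2}`, `{0,1,2}` of the three-point frame. [folklore] -/
def threeHul : Set (Set (Fin 3)) := {{0, 1}, {1, 2}, Set.univ}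

open scoped Classical in
/-- **The three-point hull frame**: hull-sets `threeHul`, everything relatively compact, and «admits a hull» := the intersection of the
hull-sets containing `U` is a hull-set (the frame axiom `hull_mem` then holds by definition). [folklore] -/
def threeFrame : HullFrame (Fin 3) where
  Hul := threeHul
  IsBounded := fun _ => True
  HasHull := fun U => (⋂₀ {H | H ∈ threeHul ∧ U ⊆ H}) ∈ threeHul
  hul_bounded := fun _ _ => trivial
  bounded_mono := fun _ _ _ _ => trivial
  exists_hul := fun U _ => ⟨Set.univ, by simp [threeHul], Set.subset_univ U⟩
  hull_mem := fun _ _ hh => hh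

/-- Volume on the three-point frame: cardinality. [folklore] -/
def threeVol (A : Set (Fin 3)) : ℝ := A.ncard

/-- Print's `P`: the region `{0, 2}` (not a hull-set). [folklore] -/
def threeP : Set (Fin 3) := {0, 2}

/-- The hull of `P = {0,2}` is everything: the only hull-set containing both `0` and `2` is `{0,1,2}`. [folklore] -/
theorem hull_threeP : threeFrame.hull threeP = Set.univ := by
  have hb : threeFrame.IsBounded threeP := trivial
  unfold HullFrame.hull
  rw [if_pos hb]
  apply Set.Subset.antisymm (Set.subset_univ _)
  intro x _
  refine Set.mem_sInter.2 fun H hH => ?_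
  obtain ⟨hH, hPH⟩ := hH
  have h0 : (0 : Fin 3) ∈ H := hPH (by simp [threeP])
  have h2 : (2 : Fin 3) ∈ H := hPH (by simp [threeP])
  simp only [threeFrame, threeHul, Set.mem_insert_iff, Set.mem_singleton_iff] at hH
  rcases hH with rfl | rfl | rfl
  · exact absurd h2 (by decide)
  · exact absurd h0 (by decide)
  · exact Set.mem_univ x

/-- `μ(P) = 2`. [folklore] -/
theorem threeVol_P : threeVol threeP = 2 := by
  unfold threeVol threeP
  rw [Set.ncard_pair (by decide)]
  norm_num

/-- `μ({0,1}) = 2`. [folklore] -/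
theorem threeVol_01 : threeVol ({0, 1} : Set (Fin 3)) = 2 := by
  unfold threeVol
  rw [Set.ncard_pair (by decide)]
  norm_num

/-- `μ({1,2}) = 2`. [folklore] -/
theorem threeVol_12 : threeVol ({1, 2} : Set (Fin 3)) = 2 := by
  unfold threeVol
  rw [Set.ncard_pair (by decide)]
  norm_num

/-- `μ(φ(P)) = 3`. [folklore] -/
theorem threeVol_univ : threeVol (Set.univ : Set (Fin 3)) = 3 := by
  unfold threeVol
  rw [Set.ncard_univ, Nat.card_eq_fintype_card, Fintype.card_fin]
  norm_num

/-- **`Ξ(P) = {{0,1}, {1,2}}`**: the two proper hull-sets are equal-volume approximants of `P` inside `φ(P)`; `φ(P)` itself is not (volume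
3 ≠ 2). [folklore] -/
theorem xiApproxOf_threeP : xiApproxOf threeFrame threeVol threeP = {{0, 1}, {1, 2}} := by
  ext H
  simp only [xiApproxOf, hull_threeP, Set.subset_univ, true_and, Set.mem_setOf_eq, Set.mem_insert_iff,
    Set.mem_singleton_iff, threeVol_P]
  constructor
  · rintro ⟨hH, hvol⟩
    simp only [threeFrame, threeHul, Set.mem_insert_iff, Set.mem_singleton_iff] at hH
    rcases hH with rfl | rfl | rfl
    · exact Or.inl rfl
    · exact Or.inr rfl
    · rw [threeVol_univ] at hvol; norm_num at hvol
  · rintro (rfl | rfl)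
    · exact ⟨by simp [threeFrame, threeHul], threeVol_01⟩
    · exact ⟨by simp [threeFrame, threeHul], threeVol_12⟩

/-- **`H^Ξ(P) = φ(P)`** («by considering various translates of H0, H1 … one verifies immediately that H_P corresponds not only to φ(P) = H^Φ(P),
but also to H^Ξ(P)», p. 129 l. 33–36): the union of the two equal-volume approximants is the whole hull. [folklore] -/
theorem sUnion_xiApproxOf_threeP : ⋃₀ xiApproxOf threeFrame threeVol threeP = Set.univ := by
  rw [xiApproxOf_threeP]
  ext x
  simp only [Set.sUnion_insert, Set.sUnion_singleton, Set.mem_union, Set.mem_insert_iff, Set.mem_singleton_iff,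
    Set.mem_univ, iff_true]
  fin_cases x <;> simp

/-- **(Ξ3) at the interface: `μ(P) = 2 < 3 = μ(H^Ξ(P)) = μ(φ(P))`** — the region's volume is STRICTLY below the volume of the union of
its equal-volume hull-approximants, which equals the hull's (print: `1 < 2 − p⁻¹`, hull `p`). [claim: Mochizuki2012, status: disputed] -/
theorem xi3_threeP :
    threeVol threeP < threeVol (⋃₀ xiApproxOf threeFrame threeVol threeP) ∧
      threeVol (⋃₀ xiApproxOf threeFrame threeVol threeP) = threeVol (threeFrame.hull threeP) := by
  rw [sUnion_xiApproxOf_threeP, hull_threeP, threeVol_P, threeVol_univ]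
  norm_num

end ThreePoint

end Summit.ABC.IUTFork.Repair.CandMochizukiHullApprox

end
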